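import Summits.NavierStokesRegularity.FunctionalMining.NoGo.TopEigHeatPeriodicMean
import Summits.NavierStokesRegularity.FunctionalMining.TopEigLaminateRigid
import HarnessLib

/-!
# FunctionalMining / NoGo — the mean-defect Poincaré inequality for the regularised VECTOR profile of a
# laminate (door (c), node K6, Lemma L-λ(q), every real `q > 1`; file 2 of 3)

search for candidate a priori estimates; no regularity claim. Cell `pub-nsfunc`, nogo seat (gen 47),
file K38b. Static calculus of explicit smooth periodic profiles; nothing about Navier–Stokes dynamics.

Setting: `A = (A₀, A₁, A₂) : Fin 3 → ShearProfile` (the polarisation of a laminate `u = A(k·x)`,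
`TopEigLaminateRigid`), `W = |A′|² = prof0 A`, `|A″|² = profDD A`, `A′·A″ = prof01 A`, `η ≠ 0`,
`β = (q−2)/2`.
* `vPairing A q η c = ∫₀¹ q·(W_c + η²)^β·(P_c·A‴)`, `P_c = A′ + cA‴`, `W_c = |P_c|² = vW A c` — the
  `η`-regularised pairing whose value at `η = c = 0` is (up to the factor `−|k|²(|k|²/4)^{q/2}`) the heat
  dissipation of `∫(λ₁⁺)^q` at the laminate (file 3);
* `vPairing_eta_zero` — integration by parts over the period:
  `vPairing A q η 0 = −q∫₀¹ (W+η²)^β/(W+η²)·((W+η²)|A″|² + 2β(A′·A″)²)`, hence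
  **`integral_profDD_le_neg_vPairing`: `q·min(1,q−1)·∫₀¹(W+η²)^β|A″|² ≤ −vPairing A q η 0`** (`q > 1`);
* **`six_integral_prof0_le`** (MEAN-DEFECT POINCARÉ): `6∫₀¹((W+η²)^γ)²W ≤ max(1,(1+2γ)²)∫₀¹((W+η²)^γ)²|A″|²`
  (`γ > −1`): with `uᵢ = (W+η²)^γAᵢ′`, `mᵢ = ∫₀¹uᵢ`, the function `Σmᵢ·Aᵢ′` has zero period integral, hence a
  zero `s₀`, where `Σmᵢ² ≤ Σ(uᵢ(s₀) − mᵢ)²`; the sup bound of file 1 controls `Σ(uᵢ(s) − mᵢ)²` for every `s`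
  by `(1/12)∫₀¹Σuᵢ′²`, and `Σuᵢ′² ≤ max(1,(1+2γ)²)((W+η²)^γ)²|A″|²` pointwise (`sum_regDeriv_sq_le`);
* **`vlam_regularised_coercive`**: `6q·min(1,q−1)·∫₀¹(W+η²)^βW ≤ max(1, q²/4)·(−vPairing A q η 0)`, every real
  `q > 1`, `η ≠ 0` — the regularised core; file 3 (`TopEigHeatVectorLaminate`) sends `η → 0⁺`.
The constant `6` (in place of the `x₂`-laminate Dirichlet constant `π²` of K37) is not claimed sharp.
[ours, calibration] search for candidate a priori estimates; no regularity claim.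
FILING (prove seat g28, REQUEST #58): declarations byte-identical to the no-go seat's staged `TopEigHeatVectorLaminateMean.STAGING.lean` 94cbb1dc91386c6b; this line is the only addition (re-cut from the v2 restage).
-/

noncomputable section

open MeasureTheory Set intervalIntegral Real

namespace Summit.NavierStokesRegularity.FunctionalMining
open Literature.Analysis Literature.Analysis.FunctionSpaces Literature.Analysis.FunctionSpaces.Torus
open TopEig

namespace TopEigLaminate

/-! ## 1. The regularised pairing of a vector laminate and its integration by parts -/

variable (A : Fin 3 → ShearProfile)

/-- `Σᵢ Aᵢ′·Aᵢ″ = ½ W′`. [ours; bookkeeping] -/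
def prof01 (s : ℝ) : ℝ := ∑ i, (A i).D s * (A i).D.D s

/-- `W_c(s) = |P_c(s)|² = Σᵢ (Aᵢ′(s) + c·Aᵢ‴(s))²` — the squared vector profile along the heat line. [ours;
bookkeeping] -/
def vW (c s : ℝ) : ℝ := ∑ i, ((A i).D s + c * (A i).D.D.D s) ^ 2

/-- **The `η`-regularised pairing** `vPairing A q η c = ∫₀¹ q·(W_c + η²)^{(q−2)/2}·(P_c·A‴)`. [ours] -/
def vPairing (q η c : ℝ) : ℝ :=
  ∫ s in (0 : ℝ)..1, q * ((vW A c s + η ^ 2) ^ ((q - 2) / 2) * ∑ i, ((A i).D s + c * (A i).D.D.D s) * (A i).D.D.D s)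

/-- `W_0 = |A′|²`. [bookkeeping] -/
theorem vW_zero (s : ℝ) : vW A 0 s = prof0 A s := by simp [vW, prof0]

/-- `W_c = |A′|² + 2c(A′·A‴) + c²|A‴|²`. [bookkeeping] -/
theorem vW_expand (c s : ℝ) : vW A c s = prof0 A s + 2 * c * prof1 A s + c ^ 2 * prof2 A s := by
  simp only [vW, prof0, prof1, prof2, Fin.sum_univ_three]
  ring

/-- `0 ≤ W_c`. [bookkeeping] -/
theorem vW_nonneg (c s : ℝ) : 0 ≤ vW A c s := Finset.sum_nonneg fun _ _ => sq_nonneg _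

/-- `0 ≤ |A′|²`. [bookkeeping] -/
theorem prof0_nonneg (s : ℝ) : 0 ≤ prof0 A s := Finset.sum_nonneg fun _ _ => sq_nonneg _

/-- `0 ≤ |A″|²`. [bookkeeping] -/
theorem profDD_nonneg (s : ℝ) : 0 ≤ profDD A s := Finset.sum_nonneg fun _ _ => sq_nonneg _

/-- `(A′·A″)² ≤ |A′|²|A″|²`. [folklore] -/
theorem prof01_sq_le (s : ℝ) : prof01 A s ^ 2 ≤ prof0 A s * profDD A s :=
  Finset.sum_mul_sq_le_sq_mul_sq _ _ _

/-- `vPairing A q η 0 = ∫₀¹ q(W + η²)^{(q−2)/2}·(A′·A‴)`. [ours; bookkeeping] -/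
theorem vPairing_zero_right (q η : ℝ) :
    vPairing A q η 0 = ∫ s in (0 : ℝ)..1, q * ((prof0 A s + η ^ 2) ^ ((q - 2) / 2) * prof1 A s) := by
  simp only [vPairing, vW_zero, zero_mul, add_zero, prof1]

/-- `W′ = 2·(A′·A″)`. [ours; bookkeeping] -/
theorem hasDerivAt_prof0 (s : ℝ) : HasDerivAt (prof0 A) (2 * prof01 A s) s := by
  have hd : ∀ (Q : ShearProfile) (x : ℝ), HasDerivAt (Q : ℝ → ℝ) (Q.D x) x := fun Q x =>
    ((Q.contDiff.differentiable (by simp)) x).hasDerivAt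
  have e : prof0 A = fun x => ∑ i, (A i).D x * (A i).D x := funext fun x => by simp [prof0, sq]
  rw [e]
  refine (HasDerivAt.fun_sum fun i _ => (hd (A i).D s).mul (hd (A i).D s)).congr_deriv ?_
  simp only [prof01, Finset.mul_sum]
  exact Finset.sum_congr rfl fun i _ => by ring

/-- `|A′|²` is `1`-periodic. [bookkeeping] -/
theorem prof0_periodic : Function.Periodic (prof0 A) 1 := fun s => by
  have h : ∀ i, (A i).D (s + 1) = (A i).D s := fun i => (A i).D.periodic s
  simp only [prof0, h]

/-- `A′·A″` is `1`-periodic. [bookkeeping] -/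
theorem prof01_periodic : Function.Periodic (prof01 A) 1 := fun s => by
  have h : ∀ i, (A i).D (s + 1) = (A i).D s := fun i => (A i).D.periodic s
  have h' : ∀ i, (A i).D.D (s + 1) = (A i).D.D s := fun i => (A i).D.D.periodic s
  simp only [prof01, h, h']

/-- `0 < |A′|² + η²` for `η ≠ 0`. [bookkeeping] -/
theorem prof0_add_sq_pos {η : ℝ} (hη : η ≠ 0) (s : ℝ) : 0 < prof0 A s + η ^ 2 := by
  have := prof0_nonneg A s; positivity

/-- **Integration by parts at `η ≠ 0`**: `vPairing A q η 0 = −q∫₀¹ (W+η²)^β/(W+η²)·((W+η²)|A″|² + 2β(A′·A″)²)`,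
`β = (q−2)/2` (everything smooth and `1`-periodic; no boundary terms). [ours] -/
theorem vPairing_eta_zero {η : ℝ} (hη : η ≠ 0) (q : ℝ) :
    vPairing A q η 0 = -(q * ∫ s in (0 : ℝ)..1, (prof0 A s + η ^ 2) ^ ((q - 2) / 2) / (prof0 A s + η ^ 2) *
      ((prof0 A s + η ^ 2) * profDD A s + 2 * ((q - 2) / 2) * prof01 A s ^ 2)) := by
  set β := (q - 2) / 2 with hβ
  have hd : ∀ (Q : ShearProfile) (x : ℝ), HasDerivAt (Q : ℝ → ℝ) (Q.D x) x := fun Q x =>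
    ((Q.contDiff.differentiable (by simp)) x).hasDerivAt
  have hw0 := prof0_add_sq_pos A hη
  have hcw : Continuous fun s => prof0 A s + η ^ 2 :=
    (continuous_finsetSum _ fun i _ => ((A i).D.continuous.pow 2)).add continuous_const
  have hcwβ : Continuous fun s => (prof0 A s + η ^ 2) ^ β := hcw.rpow_const fun s => Or.inl (hw0 s).ne'
  have hcwβ1 : Continuous fun s => (prof0 A s + η ^ 2) ^ (β - 1) := hcw.rpow_const fun s => Or.inl (hw0 s).ne'
  have hc01 : Continuous (prof01 A) := continuous_finsetSum _ fun i _ => (A i).D.continuous.mul (A i).D.D.continuous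
  -- the regularised coordinates `gᵢ = (W+η²)^β Aᵢ′` and their derivatives
  have hg : ∀ i s, HasDerivAt (fun x => (prof0 A x + η ^ 2) ^ β * (A i).D x)
      (2 * prof01 A s * β * (prof0 A s + η ^ 2) ^ (β - 1) * (A i).D s + (prof0 A s + η ^ 2) ^ β * (A i).D.D s) s :=
    fun i s => (((hasDerivAt_prof0 A s).add_const (η ^ 2)).rpow_const (Or.inl (hw0 s).ne')).mul (hd _ s)
  -- per-coordinate integration by parts
  have hibp : ∀ i, ∫ s in (0 : ℝ)..1, (prof0 A s + η ^ 2) ^ β * (A i).D s * (A i).D.D.D s =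
      -∫ s in (0 : ℝ)..1, (2 * prof01 A s * β * (prof0 A s + η ^ 2) ^ (β - 1) * (A i).D s +
        (prof0 A s + η ^ 2) ^ β * (A i).D.D s) * (A i).D.D s := by
    intro i
    have h := intervalIntegral.integral_mul_deriv_eq_deriv_mul (a := 0) (b := 1)
      (u := fun x => (prof0 A x + η ^ 2) ^ β * (A i).D x) (v := ((A i).D.D : ℝ → ℝ))
      (u' := fun s => 2 * prof01 A s * β * (prof0 A s + η ^ 2) ^ (β - 1) * (A i).D s +
        (prof0 A s + η ^ 2) ^ β * (A i).D.D s)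
      (v' := ((A i).D.D.D : ℝ → ℝ)) (fun x _ => hg i x) (fun x _ => hd _ x)
      ((((continuous_const.mul hc01).mul continuous_const).mul hcwβ1 |>.mul (A i).D.continuous).add
        (hcwβ.mul (A i).D.D.continuous) |>.intervalIntegrable _ _) ((A i).D.D.D.continuous.intervalIntegrable _ _)
    have hp0 : prof0 A 1 = prof0 A 0 := by have := prof0_periodic A 0; rwa [zero_add] at this
    have hp1 : (A i).D 1 = (A i).D 0 := by have := (A i).D.periodic 0; rwa [zero_add] at this
    have hp2 : (A i).D.D 1 = (A i).D.D 0 := by have := (A i).D.D.periodic 0; rwa [zero_add] at this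
    rw [h]
    simp only [hp0, hp1, hp2, sub_self, zero_sub]
  -- assemble
  rw [vPairing_zero_right, intervalIntegral.integral_const_mul, ← mul_neg, ← hβ]
  congr 1
  have e1 : ∀ s, (prof0 A s + η ^ 2) ^ β * prof1 A s = ∑ i, (prof0 A s + η ^ 2) ^ β * (A i).D s * (A i).D.D.D s :=
    fun s => by simp only [prof1, Finset.mul_sum]; exact Finset.sum_congr rfl fun i _ => by ring
  simp_rw [e1]
  rw [intervalIntegral.integral_finsetSum (f := fun i s => (prof0 A s + η ^ 2) ^ β * (A i).D s * (A i).D.D.D s)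
    fun i _ => ((hcwβ.mul (A i).D.continuous).mul (A i).D.D.D.continuous).intervalIntegrable _ _]
  simp_rw [hibp]
  rw [Finset.sum_neg_distrib, ← intervalIntegral.integral_finsetSum (f := fun i s =>
    (2 * prof01 A s * β * (prof0 A s + η ^ 2) ^ (β - 1) * (A i).D s + (prof0 A s + η ^ 2) ^ β * (A i).D.D s) *
      (A i).D.D s) fun i _ => ?_]
  · congr 1
    refine intervalIntegral.integral_congr fun s _ => ?_
    have hws := (hw0 s).ne'
    simp only [Fin.sum_univ_three, prof01, profDD, prof0] at *
    rw [Real.rpow_sub_one hws]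
    field_simp
    ring
  · exact (((((continuous_const.mul hc01).mul continuous_const).mul hcwβ1 |>.mul (A i).D.continuous).add
      (hcwβ.mul (A i).D.D.continuous)).mul (A i).D.D.continuous).intervalIntegrable _ _

/-- **`q·min(1, q−1)·∫₀¹ (W+η²)^β|A″|² ≤ −vPairing A q η 0`** (`η ≠ 0`, real `q > 1`, `β = (q−2)/2`). [ours] -/
theorem integral_profDD_le_neg_vPairing {η : ℝ} (hη : η ≠ 0) {q : ℝ} (hq : 1 < q) :
    q * min 1 (q - 1) * ∫ s in (0 : ℝ)..1, (prof0 A s + η ^ 2) ^ ((q - 2) / 2) * profDD A s ≤ -vPairing A q η 0 := by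
  have hq0 : 0 < q := by linarith
  have hw0 := prof0_add_sq_pos A hη
  have hcw : Continuous fun s => prof0 A s + η ^ 2 :=
    (continuous_finsetSum _ fun i _ => ((A i).D.continuous.pow 2)).add continuous_const
  have hc0 : Continuous (prof0 A) := continuous_finsetSum _ fun i _ => (A i).D.continuous.pow 2
  have hc01 : Continuous (prof01 A) := continuous_finsetSum _ fun i _ => (A i).D.continuous.mul (A i).D.D.continuous
  have hcDD : Continuous (profDD A) := continuous_finsetSum _ fun i _ => (A i).D.D.continuous.pow 2
  have hcβ : Continuous fun s => (prof0 A s + η ^ 2) ^ ((q - 2) / 2) := hcw.rpow_const fun s => Or.inl (hw0 s).ne'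
  rw [vPairing_eta_zero A hη q, neg_neg, mul_assoc, ← intervalIntegral.integral_const_mul]
  refine mul_le_mul_of_nonneg_left ?_ hq0.le
  refine intervalIntegral.integral_mono_on zero_le_one ((continuous_const.mul (hcβ.mul hcDD)).intervalIntegrable _ _)
    (((hcβ.div hcw fun s => (hw0 s).ne').mul ((hcw.mul hcDD).add (continuous_const.mul (hc01.pow 2)))).intervalIntegrable
      _ _) fun s _ => ?_
  have hw := hw0 s
  have h := ibp_integrand_lower (W := prof0 A s) (β := (q - 2) / 2) (profDD_nonneg A s) (prof01_sq_le A s) (sq_nonneg η)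
  rw [show (1 + 2 * ((q - 2) / 2)) = q - 1 by ring] at h
  have hpos : 0 ≤ (prof0 A s + η ^ 2) ^ ((q - 2) / 2) / (prof0 A s + η ^ 2) := (div_pos (rpow_pos_of_pos hw _) hw).le
  calc min 1 (q - 1) * ((prof0 A s + η ^ 2) ^ ((q - 2) / 2) * profDD A s)
        = (prof0 A s + η ^ 2) ^ ((q - 2) / 2) / (prof0 A s + η ^ 2) *
            (min 1 (q - 1) * ((prof0 A s + η ^ 2) * profDD A s)) := by field_simp
    _ ≤ (prof0 A s + η ^ 2) ^ ((q - 2) / 2) / (prof0 A s + η ^ 2) *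
            ((prof0 A s + η ^ 2) * profDD A s + 2 * ((q - 2) / 2) * prof01 A s ^ 2) := mul_le_mul_of_nonneg_left h hpos

/-! ## 2. The mean-defect Poincaré inequality for the regularised vector profile -/

/-- Pointwise derivative energy of the regularised coordinates `uᵢ = (W+η²)^γ Aᵢ′`:
`Σᵢ uᵢ′² ≤ max(1,(1+2γ)²)·((W+η²)^γ)²·|A″|²` (`η ≠ 0`, `γ > −1`). [ours] -/
theorem sum_regDeriv_sq_le {η : ℝ} (hη : η ≠ 0) {γ : ℝ} (hγ : -1 < γ) (s : ℝ) :
    ∑ i, (2 * prof01 A s * γ * (prof0 A s + η ^ 2) ^ (γ - 1) * (A i).D s + (prof0 A s + η ^ 2) ^ γ * (A i).D.D s) ^ 2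
      ≤ max 1 ((1 + 2 * γ) ^ 2) * (((prof0 A s + η ^ 2) ^ γ) ^ 2 * profDD A s) := by
  have hw := prof0_add_sq_pos A hη s
  have hid : ∀ c g : ℝ, ∑ i, (c * (A i).D s + g * (A i).D.D s) ^ 2 =
      c ^ 2 * prof0 A s + 2 * c * g * prof01 A s + g ^ 2 * profDD A s := fun c g => by
    simp only [prof0, prof01, profDD, Fin.sum_univ_three]; ring
  rw [hid, Real.rpow_sub_one hw.ne' γ]
  have hineq := deriv_sq_upper (prof0_nonneg A s) (profDD_nonneg A s) (prof01_sq_le A s)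
    (by nlinarith [sq_nonneg η] : prof0 A s ≤ prof0 A s + η ^ 2) hγ
  have e : (2 * prof01 A s * γ * ((prof0 A s + η ^ 2) ^ γ / (prof0 A s + η ^ 2))) ^ 2 * prof0 A s +
      2 * (2 * prof01 A s * γ * ((prof0 A s + η ^ 2) ^ γ / (prof0 A s + η ^ 2))) * (prof0 A s + η ^ 2) ^ γ * prof01 A s +
      ((prof0 A s + η ^ 2) ^ γ) ^ 2 * profDD A s =
      ((prof0 A s + η ^ 2) ^ γ / (prof0 A s + η ^ 2)) ^ 2 * (4 * γ ^ 2 * prof01 A s ^ 2 * prof0 A s +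
        4 * γ * prof01 A s ^ 2 * (prof0 A s + η ^ 2) + (prof0 A s + η ^ 2) ^ 2 * profDD A s) := by
    field_simp
    ring
  rw [e]
  calc _ ≤ ((prof0 A s + η ^ 2) ^ γ / (prof0 A s + η ^ 2)) ^ 2 *
          (max 1 ((1 + 2 * γ) ^ 2) * ((prof0 A s + η ^ 2) ^ 2 * profDD A s)) := mul_le_mul_of_nonneg_left hineq (sq_nonneg _)
    _ = _ := by field_simp

/-- **Mean-defect Poincaré inequality**: `6·∫₀¹ ((W+η²)^γ)²·W ≤ max(1,(1+2γ)²)·∫₀¹ ((W+η²)^γ)²·|A″|²`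
(`η ≠ 0`, `γ > −1`): with `uᵢ = (W+η²)^γAᵢ′` and `mᵢ = ∫₀¹uᵢ`, `Σmᵢ² ≤ Σ(uᵢ(s₀) − mᵢ)²` at a zero `s₀` of
`Σmᵢ·Aᵢ′` (`∫₀¹ Aᵢ′ = 0`), and the sup bound `sq_sub_mean_le` controls `Σ(uᵢ(s) − mᵢ)²` for every `s`, so
`∫₀¹Σuᵢ² = Σmᵢ² + ∫₀¹Σ(uᵢ−mᵢ)² ≤ (1/6)·∫₀¹Σuᵢ′²`. [ours] -/
theorem six_integral_prof0_le {η : ℝ} (hη : η ≠ 0) {γ : ℝ} (hγ : -1 < γ) :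
    6 * ∫ s in (0 : ℝ)..1, ((prof0 A s + η ^ 2) ^ γ) ^ 2 * prof0 A s ≤
      max 1 ((1 + 2 * γ) ^ 2) * ∫ s in (0 : ℝ)..1, ((prof0 A s + η ^ 2) ^ γ) ^ 2 * profDD A s := by
  have hd : ∀ (Q : ShearProfile) (x : ℝ), HasDerivAt (Q : ℝ → ℝ) (Q.D x) x := fun Q x =>
    ((Q.contDiff.differentiable (by simp)) x).hasDerivAt
  have hw0 := prof0_add_sq_pos A hη
  have hcw : Continuous fun s => prof0 A s + η ^ 2 :=
    (continuous_finsetSum _ fun i _ => ((A i).D.continuous.pow 2)).add continuous_const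
  have hc0 : Continuous (prof0 A) := continuous_finsetSum _ fun i _ => (A i).D.continuous.pow 2
  have hcDD : Continuous (profDD A) := continuous_finsetSum _ fun i _ => (A i).D.D.continuous.pow 2
  have hcγ : Continuous fun s => (prof0 A s + η ^ 2) ^ γ := hcw.rpow_const fun s => Or.inl (hw0 s).ne'
  have hcγ1 : Continuous fun s => (prof0 A s + η ^ 2) ^ (γ - 1) := hcw.rpow_const fun s => Or.inl (hw0 s).ne'
  have hc01 : Continuous (prof01 A) := continuous_finsetSum _ fun i _ => (A i).D.continuous.mul (A i).D.D.continuous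
  -- the regularised coordinates, their derivatives, means and derivative energy
  set u : Fin 3 → ℝ → ℝ := fun i s => (prof0 A s + η ^ 2) ^ γ * (A i).D s with hu
  set u' : Fin 3 → ℝ → ℝ := fun i s => 2 * prof01 A s * γ * (prof0 A s + η ^ 2) ^ (γ - 1) * (A i).D s +
    (prof0 A s + η ^ 2) ^ γ * (A i).D.D s with hu'
  have hdu : ∀ i s, HasDerivAt (u i) (u' i s) s := fun i s =>
    (((hasDerivAt_prof0 A s).add_const (η ^ 2)).rpow_const (Or.inl (hw0 s).ne')).mul (hd _ s)
  have hcu : ∀ i, Continuous (u i) := fun i => hcγ.mul (A i).D.continuous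
  have hcu' : ∀ i, Continuous (u' i) := fun i =>
    ((((continuous_const.mul hc01).mul continuous_const).mul hcγ1).mul (A i).D.continuous).add
      (hcγ.mul (A i).D.D.continuous)
  have hper : ∀ i, Function.Periodic (u i) 1 := fun i s => by
    simp only [hu, prof0_periodic A s, (A i).D.periodic s]
  have hper' : ∀ i, Function.Periodic (u' i) 1 := fun i s => by
    simp only [hu', prof0_periodic A s, prof01_periodic A s, (A i).D.periodic s, (A i).D.D.periodic s]
  set m : Fin 3 → ℝ := fun i => ∫ r in (0 : ℝ)..1, u i r with hm
  set S := ∑ i, ∫ r in (0 : ℝ)..1, u' i r ^ 2 with hS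
  -- (1) the sup bound, summed over the coordinates
  have hsup : ∀ s, ∑ i, (u i s - m i) ^ 2 ≤ 1 / 12 * S := fun s => by
    rw [hS, Finset.mul_sum]
    exact Finset.sum_le_sum fun i _ => sq_sub_mean_le (hper i) (hper' i) (hdu i) (hcu' i) s
  -- (2) the derivative energy `S ≤ max(1,(1+2γ)²)·∫((W+η²)^γ)²|A″|²`
  have hS_le : S ≤ max 1 ((1 + 2 * γ) ^ 2) * ∫ s in (0 : ℝ)..1, ((prof0 A s + η ^ 2) ^ γ) ^ 2 * profDD A s := by
    rw [hS, ← intervalIntegral.integral_finsetSum (f := fun i r => u' i r ^ 2) fun i _ =>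
      ((hcu' i).pow 2).intervalIntegrable _ _, ← intervalIntegral.integral_const_mul]
    refine intervalIntegral.integral_mono_on zero_le_one
      ((continuous_finsetSum _ fun i _ => (hcu' i).pow 2).intervalIntegrable _ _)
      ((continuous_const.mul ((hcγ.pow 2).mul hcDD)).intervalIntegrable _ _) fun s _ => ?_
    simp only [hu']
    exact sum_regDeriv_sq_le A hη hγ s
  -- (3) the mean defect at a zero `s₀` of `Σ mᵢ Aᵢ′`
  have hint0 : ∫ s in (0 : ℝ)..1, ∑ i, m i * (A i).D s = 0 := by
    rw [intervalIntegral.integral_finsetSum (f := fun i s => m i * (A i).D s) fun i _ =>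
      (continuous_const.mul (A i).D.continuous).intervalIntegrable _ _]
    refine Finset.sum_eq_zero fun i _ => ?_
    rw [intervalIntegral.integral_const_mul,
      intervalIntegral.integral_eq_sub_of_hasDerivAt (fun x _ => hd (A i) x) ((A i).D.continuous.intervalIntegrable _ _)]
    have hp : (A i) 1 = (A i) 0 := by have := (A i).periodic 0; rwa [zero_add] at this
    rw [hp, sub_self, mul_zero]
  obtain ⟨s₀, hs₀⟩ : ∃ s, ∑ i, m i * (A i).D s = 0 := exists_eq_zero_of_integral_eq_zero
    (f := fun s => ∑ i, m i * (A i).D s) (continuous_finsetSum _ fun i _ => continuous_const.mul (A i).D.continuous) hint0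
  have hmd : ∑ i, m i ^ 2 ≤ 1 / 12 * S := by
    have hz : ∑ i, m i * u i s₀ = 0 := by
      have : ∑ i, m i * u i s₀ = (prof0 A s₀ + η ^ 2) ^ γ * ∑ i, m i * (A i).D s₀ := by
        rw [Finset.mul_sum]; exact Finset.sum_congr rfl fun i _ => by simp only [hu]; ring
      rw [this, hs₀, mul_zero]
    calc ∑ i, m i ^ 2 ≤ ∑ i, m i ^ 2 + ∑ i, u i s₀ ^ 2 :=
          le_add_of_nonneg_right (Finset.sum_nonneg fun i _ => sq_nonneg _)
      _ = ∑ i, (u i s₀ - m i) ^ 2 := by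
          have e : ∑ i, (u i s₀ - m i) ^ 2 = ∑ i, u i s₀ ^ 2 - 2 * ∑ i, m i * u i s₀ + ∑ i, m i ^ 2 := by
            simp only [Fin.sum_univ_three]; ring
          rw [e, hz]; ring
      _ ≤ 1 / 12 * S := hsup s₀
  -- (4) `∫((W+η²)^γ)²W = Σmᵢ² + ∫Σ(uᵢ−mᵢ)²` and `∫Σ(uᵢ−mᵢ)² ≤ (1/12)·S`
  have hsq : ∀ s, ((prof0 A s + η ^ 2) ^ γ) ^ 2 * prof0 A s = ∑ i, u i s ^ 2 := fun s => by
    simp only [hu, mul_pow, ← Finset.mul_sum, prof0]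
  have hdecomp : ∫ s in (0 : ℝ)..1, ((prof0 A s + η ^ 2) ^ γ) ^ 2 * prof0 A s =
      ∑ i, m i ^ 2 + ∫ s in (0 : ℝ)..1, ∑ i, (u i s - m i) ^ 2 := by
    simp_rw [hsq]
    rw [intervalIntegral.integral_finsetSum (f := fun i s => u i s ^ 2) fun i _ => ((hcu i).pow 2).intervalIntegrable _ _,
      intervalIntegral.integral_finsetSum (f := fun i s => (u i s - m i) ^ 2) fun i _ =>
        (((hcu i).sub continuous_const).pow 2).intervalIntegrable _ _, ← Finset.sum_add_distrib]
    refine Finset.sum_congr rfl fun i _ => ?_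
    rw [hm, integral_sq_sub_mean (hcu i)]
    ring
  have hvar : ∫ s in (0 : ℝ)..1, ∑ i, (u i s - m i) ^ 2 ≤ 1 / 12 * S := by
    have h : (∫ s in (0 : ℝ)..1, ∑ i, (u i s - m i) ^ 2) ≤ ∫ _s in (0 : ℝ)..1, 1 / 12 * S :=
      intervalIntegral.integral_mono_on zero_le_one
        ((continuous_finsetSum _ fun i _ => ((hcu i).sub continuous_const).pow 2).intervalIntegrable _ _)
        intervalIntegrable_const fun s _ => hsup s
    rwa [intervalIntegral.integral_const, sub_zero, one_smul] at h
  -- assemble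
  calc 6 * ∫ s in (0 : ℝ)..1, ((prof0 A s + η ^ 2) ^ γ) ^ 2 * prof0 A s
        = 6 * (∑ i, m i ^ 2 + ∫ s in (0 : ℝ)..1, ∑ i, (u i s - m i) ^ 2) := by rw [hdecomp]
    _ ≤ 6 * (1 / 12 * S + 1 / 12 * S) := mul_le_mul_of_nonneg_left (add_le_add hmd hvar) (by norm_num)
    _ = S := by ring
    _ ≤ _ := hS_le

/-- **The `η`-regularised vector-laminate coercivity** (`η ≠ 0`, every real `q > 1`):
`6q·min(1,q−1)·∫₀¹ (W+η²)^{(q−2)/2}·W ≤ max(1, q²/4)·(−vPairing A q η 0)`. [ours] -/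
theorem vlam_regularised_coercive {η : ℝ} (hη : η ≠ 0) {q : ℝ} (hq : 1 < q) :
    6 * q * min 1 (q - 1) * ∫ s in (0 : ℝ)..1, (prof0 A s + η ^ 2) ^ ((q - 2) / 2) * prof0 A s ≤
      max 1 (q ^ 2 / 4) * -vPairing A q η 0 := by
  have hw0 := prof0_add_sq_pos A hη
  have hγ : -1 < (q - 2) / 4 := by linarith
  have hsq : ∀ s, ((prof0 A s + η ^ 2) ^ ((q - 2) / 4)) ^ 2 = (prof0 A s + η ^ 2) ^ ((q - 2) / 2) := fun s => by
    rw [← Real.rpow_natCast, ← Real.rpow_mul (hw0 s).le]; congr 1; push_cast; ring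
  have h6 := six_integral_prof0_le A hη hγ
  have hDD := integral_profDD_le_neg_vPairing A hη hq
  simp_rw [hsq] at h6
  rw [show (1 + 2 * ((q - 2) / 4)) ^ 2 = q ^ 2 / 4 by ring] at h6
  have hM : 0 ≤ max 1 (q ^ 2 / 4) := le_max_of_le_left zero_le_one
  have hmin : 0 ≤ q * min 1 (q - 1) := mul_nonneg (by linarith) (le_min zero_le_one (by linarith))
  calc 6 * q * min 1 (q - 1) * ∫ s in (0 : ℝ)..1, (prof0 A s + η ^ 2) ^ ((q - 2) / 2) * prof0 A s
        = q * min 1 (q - 1) * (6 * ∫ s in (0 : ℝ)..1, (prof0 A s + η ^ 2) ^ ((q - 2) / 2) * prof0 A s) := by ring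
    _ ≤ q * min 1 (q - 1) * (max 1 (q ^ 2 / 4) * ∫ s in (0 : ℝ)..1, (prof0 A s + η ^ 2) ^ ((q - 2) / 2) * profDD A s) :=
        mul_le_mul_of_nonneg_left h6 hmin
    _ = max 1 (q ^ 2 / 4) * (q * min 1 (q - 1) * ∫ s in (0 : ℝ)..1, (prof0 A s + η ^ 2) ^ ((q - 2) / 2) * profDD A s) := by
        ring
    _ ≤ max 1 (q ^ 2 / 4) * -vPairing A q η 0 := mul_le_mul_of_nonneg_left hDD hM

end TopEigLaminate

end Summit.NavierStokesRegularity.FunctionalMining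

end
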